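import Literature.Topology.FourManifolds.LatticeFormsSpecialOrthogonalReflectionPairs
import HarnessLib

/-!
# `O(U^{⊕n})` is generated by the NEGATED reflections `−σ_v`, `v² = ±2`; `−id ∈ SO⁺(U^{⊕n}) ⟺ n` even; and for `n` even
# `⟨−σ_v : v² = −2⟩ = O⁺(U^{⊕n})` — the lattice half of Markman's "`ρ(Pin(V)) = O₊(V)`, `ρ(Spin(V)) = SO₊(V)`" for `V ≅ U^{⊕4}`
# (Markman, *JEMS* (2023) §5.1; Gritsenko–Hulek–Sankaran 2009 Thm. 1.1, Cor. 1.8; Wall 1962 via Markman)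

Trunk T-4MAN vocabulary. In Markman's set-up `V = H¹(X,ℤ) ⊕ H¹(X,ℤ)* ≅ U^{⊕4}` (`X` an abelian surface), the Clifford group acts on
`V` by `ρ(x)(v) = x·v·x⁻¹`, and for `(v,v) = ±2` the element `−ρ(v)` is the reflection in `v`; so `ρ(v) = −σ_v` is a NEGATED
reflection, and the lattice statements behind the Lemma of §5.1 are: `O(V)` is generated by the `−σ_v`, `(v,v) = ±2` (because
`−id_V` is a product of an even number of reflections), `⟨−σ_v : (v,v) = −2⟩ = O₊(V)` and the even words give `SO₊(V)`. This file
proves them for every `U^{⊕n}`, `n ≥ 3` (the `O₊` statement for `n` even, which is what makes `−id ∈ O₊`), from Wall's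
`O(U^{⊕n}) = ⟨σ_v : v² = ±2⟩` (row g49-#15), Kneser's form (rows g49-#15, g50-#4) and the characters of `−id`. Written for lane
`lit-hodgefound` (Track 2 foundations; prover seat `lit-hodgefound-p18`, gen 50, row g50-#7). THEOREMS ONLY — no definition, no
named fact, no instance, no notation.

## Source, verbatim (Markman 2023, held `paper:arxiv-1805.11574`, §5.1 p. 14)

"If `Q(v) = ±1`, then `−ρ(v)` is reflection by `v`: `−ρ(v)(w) = w − (2(v,w)_V/(v,v)_V)·v`." "**Lemma.** […] The homomorphism `ρ`
is surjective and it maps `Pin(V)` onto `O₊(V)` and `Spin(V)` onto `SO₊(V)`. *Proof.* The lattice `V` is the orthogonal direct sum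
of four copies of the even unimodular rank `2` hyperbolic lattice `U`. Hence, `O(V)` is generated by the reflections `−ρ(v)` […] by
elements `v ∈ V` with `(v,v)_V = ±2`, by [wall]. The element `−id_U ∈ O(U)` is a product of two reflections. Hence, `−id_V` is a
product of `8` reflections and so `O(V)` is generated by the set `{ρ(v) : v ∈ V, (v,v)_V = ±2}`." (`Pin(V)` is generated by the
`v` with `Q(v) = −1`, i.e. `(v,v)_V = −2`; `O₊(V) = ker(ort)`.)

## Contents (all proved)

* §1 (any lattice) `−id` commutes with every isometry; a product of letters `s·(−id)` equals `(−1)^{length}` times the product of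
  the letters (`wordProd_map_trans_neg_apply`); hence words in `{s·(−id) : s ∈ S}` from words in `S` of even length, or of any length
  once `−id` itself is such a word (`isWordIn_negs_wordProd`).
* §2 `U^{⊕n}`: `det(−id) = 1`, **`−id ∈ O⁺(U^{⊕n}) ⟺ n` even** (`hyperbolicSum_isOrientationPreserving_neg_iff`),
  **`−id ∈ [O, O] ⟺ n` even** (`n ≥ 3`); **`O(U^{⊕n}) = ⟨−σ_v : v² = ±2⟩`** (`hyperbolicSum_isWordIn_negReflections`, `n ≥ 3`);
  **`⟨−σ_v : v² = −2⟩ = O⁺(U^{⊕n})` for `n ≥ 3` even** (`hyperbolicSum_isWordIn_negNegTwoReflections_iff`);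
  **`⟨(−σ_a)(−σ_b) : a² = b² = −2⟩ = SO⁺(U^{⊕n})`** (`hyperbolicSum_isWordIn_negNegTwoReflectionPairs_iff`, `n ≥ 3`).
* §3 the same for every lattice `L ≅ U^{⊕n}` (Markman's `V`, `n = 4`).
-/

noncomputable section

open Module
open LinearMap (BilinForm)
open LinearMap.BilinForm
open LinearMap.BilinForm (IsometryEquiv)

namespace Literature.Topology.FourManifolds

universe u

/-! ### §1 Words in negated letters -/

section Negs

variable {W : Type*} [AddCommGroup W] {B : BilinForm ℤ W}

/-- **A product of negated letters**: `wordProd [s₁·(−id), …, s_k·(−id)] = (−1)^k · wordProd [s₁, …, s_k]` pointwise (`−id` is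
central). [cite: Markman2023GeneralizedKummers, §5.1 (proof of the Lemma: "−id_V is a product of 8 reflections and so O(V) is generated by the set {ρ(v)}")] -/
theorem wordProd_map_trans_neg_apply (l : List (B.IsometryEquiv B)) (v : W) :
    wordProd (l.map fun s ↦ s.trans (LinearMap.BilinForm.IsometryEquiv.neg B)) v = ((-1 : ℤ) ^ l.length) • wordProd l v := by
  induction l generalizing v with
  | nil => rw [List.map_nil, wordProd_nil, List.length_nil, pow_zero, one_smul]
  | cons s l ih =>
    rw [List.map_cons, wordProd_cons, wordProd_cons, LinearMap.BilinForm.IsometryEquiv.trans_apply,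
      LinearMap.BilinForm.IsometryEquiv.trans_apply, LinearMap.BilinForm.IsometryEquiv.trans_apply,
      LinearMap.BilinForm.IsometryEquiv.neg_apply, ih, map_neg, List.length_cons, pow_succ, mul_smul, neg_one_smul]

/-- **Words in negated letters**: if `l` is a list of members of `S`, then `wordProd l` is a word in `{s·(−id) : s ∈ S}` provided
`l` has even length, OR provided `−id` itself is such a word. [cite: Markman2023GeneralizedKummers, §5.1 (proof of the Lemma)] -/
theorem isWordIn_negs_wordProd {S : Set (B.IsometryEquiv B)} (l : List (B.IsometryEquiv B)) (hl : ∀ s ∈ l, s ∈ S)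
    (h : Even l.length ∨ IsWordIn {χ : B.IsometryEquiv B | ∃ s ∈ S, χ = s.trans (LinearMap.BilinForm.IsometryEquiv.neg B)}
      (LinearMap.BilinForm.IsometryEquiv.neg B)) :
    IsWordIn {χ : B.IsometryEquiv B | ∃ s ∈ S, χ = s.trans (LinearMap.BilinForm.IsometryEquiv.neg B)} (wordProd l) := by
  have hw : IsWordIn {χ : B.IsometryEquiv B | ∃ s ∈ S, χ = s.trans (LinearMap.BilinForm.IsometryEquiv.neg B)}
      (wordProd (l.map fun s ↦ s.trans (LinearMap.BilinForm.IsometryEquiv.neg B))) :=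
    ⟨l.map fun s ↦ s.trans (LinearMap.BilinForm.IsometryEquiv.neg B), fun ψ hψ ↦ by
      obtain ⟨s, hs, rfl⟩ := List.mem_map.1 hψ
      exact Or.inl ⟨s, hl s hs, rfl⟩, fun v ↦ rfl⟩
  rcases Nat.even_or_odd l.length with he | ho
  · exact hw.congr fun v ↦ by rw [wordProd_map_trans_neg_apply, he.neg_one_pow, one_smul]
  · rcases h with he | hneg
    · exact absurd he (Nat.not_even_iff_odd.2 ho)
    · exact (hw.trans hneg).congr fun v ↦ by
        rw [LinearMap.BilinForm.IsometryEquiv.trans_apply, wordProd_map_trans_neg_apply, ho.neg_one_pow, neg_one_smul,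
          LinearMap.BilinForm.IsometryEquiv.neg_apply, neg_neg]

/-- `(σ_a·(−id))·(σ_b·(−id)) = σ_a·σ_b`: pairs of negated letters are pairs of letters (`−id` central, `(−id)² = id`).
[cite: Markman2023GeneralizedKummers, §5.1 ("ρ maps Spin(V) onto SO₊(V)")] -/
theorem trans_neg_trans_trans_neg (s t : B.IsometryEquiv B) :
    (s.trans (LinearMap.BilinForm.IsometryEquiv.neg B)).trans (t.trans (LinearMap.BilinForm.IsometryEquiv.neg B)) = s.trans t :=
  DFunLike.ext _ _ fun v ↦ by
    simp only [LinearMap.BilinForm.IsometryEquiv.trans_apply, LinearMap.BilinForm.IsometryEquiv.neg_apply, map_neg, neg_neg]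

end Negs

/-! ### §2 `U^{⊕n}` -/

section HyperbolicSum

/-- **`det(−id) = 1` on `U^{⊕n}`** (rank `2n`). [cite: Markman2023GeneralizedKummers, §5.1 ("−id_V is a product of 8 reflections")] [cite: Huybrechts2016K3, Ch. 7 §5.4 Thm. 5.7] -/
theorem hyperbolicSum_det_neg (n : ℕ) :
    LinearMap.det ((LinearMap.BilinForm.IsometryEquiv.neg (hyperbolicSum n) : (hyperbolicSum n).IsometryEquiv (hyperbolicSum n)) :
      (Fin n → ℤ) × (Fin n → ℤ) →ₗ[ℤ] (Fin n → ℤ) × (Fin n → ℤ)) = 1 := by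
  rw [LinearMap.BilinForm.IsometryEquiv.det_neg, finrank_hyperbolicSum_carrier, pow_mul]
  norm_num

/-- **`−id ∈ O⁺(U^{⊕n}) ⟺ n` is even** (`n₊(U^{⊕n}) = n`). [cite: Huybrechts2016K3, Ch. 7 §5.4 Prop. 5.5] [cite: Markman2023GeneralizedKummers, §5.1 ("ρ maps Pin(V) onto O₊(V)", V ≅ U^{⊕4})] -/
theorem hyperbolicSum_isOrientationPreserving_neg_iff (n : ℕ) :
    (LinearMap.BilinForm.IsometryEquiv.neg (hyperbolicSum n)).IsOrientationPreserving ↔ Even n := by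
  rw [LinearMap.BilinForm.IsometryEquiv.isOrientationPreserving_neg_iff (Q := hyperbolicSum n) (isSymm_hyperbolicSum n)
    (isUnimodular_hyperbolicSum n).nondegenerate, (sigPos_sigNeg_hyperbolicSum n).1]

/-- **`−id ∈ [O(U^{⊕n}), O(U^{⊕n})] = SO⁺(U^{⊕n}) ⟺ n` is even**, `n ≥ 3`. [cite: GritsenkoHulekSankaran2009, Cor. 1.8 and Thm. 1.7] [cite: Markman2023GeneralizedKummers, §5.1] -/
theorem hyperbolicSum_isWordIn_commutators_neg_iff {n : ℕ} (hn : 3 ≤ n) :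
    IsWordIn {ψ | ∃ α β : (hyperbolicSum n).IsometryEquiv (hyperbolicSum n), ψ = ((β.symm.trans α.symm).trans β).trans α}
      (LinearMap.BilinForm.IsometryEquiv.neg (hyperbolicSum n)) ↔ Even n := by
  rw [hyperbolicSum_isWordIn_commutators_iff hn, hyperbolicSum_det_neg, hyperbolicSum_isOrientationPreserving_neg_iff]
  exact and_iff_left rfl

/-- **`−id_V` is a product of an even number of `(±2)`-reflections, hence a word in the negated reflections `−σ_v`, `v² = ±2`**
(`n ≥ 3`). [cite: Markman2023GeneralizedKummers, §5.1 (proof of the Lemma: "−id_V is a product of 8 reflections")] -/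
theorem hyperbolicSum_isWordIn_negReflections_neg {n : ℕ} (hn : 3 ≤ n) :
    IsWordIn {χ : (hyperbolicSum n).IsometryEquiv (hyperbolicSum n) | ∃ s ∈ {ψ : (hyperbolicSum n).IsometryEquiv (hyperbolicSum n) |
        ∃ (r : (Fin n → ℤ) × (Fin n → ℤ)) (ε : ℤ) (hε : ε * ε = 1) (hr : hyperbolicSum n r r = ε + ε),
          ψ = normTwoReflectionEquiv (isSymm_hyperbolicSum n) r ε hr hε},
        χ = s.trans (LinearMap.BilinForm.IsometryEquiv.neg (hyperbolicSum n))}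
      (LinearMap.BilinForm.IsometryEquiv.neg (hyperbolicSum n)) := by
  obtain ⟨hS, hSdet⟩ := reflections_symm_mem_and_det' (isSymm_hyperbolicSum n)
  obtain ⟨l, hl, hlφ⟩ := (hyperbolicSum_isWordIn_reflections hn (LinearMap.BilinForm.IsometryEquiv.neg (hyperbolicSum n))).exists_list_of_symm_mem hS
  have heven : Even l.length := by
    rcases Nat.even_or_odd l.length with h | h
    · exact h
    · have hd := det_wordProd_eq_neg_one_pow l fun s hs ↦ hSdet s (hl s hs)
      rw [DFunLike.ext _ _ hlφ, hyperbolicSum_det_neg, h.neg_one_pow] at hd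
      norm_num at hd
  exact (isWordIn_negs_wordProd l hl (Or.inl heven)).congr hlφ

/-- **`O(U^{⊕n}) = ⟨−σ_v : v² = ±2⟩`, `n ≥ 3`** — every isometry of `hyperbolicSum n` is a word in the NEGATED reflections
`σ_v·(−id)`, `(v,v) = ±2` (Wall's `O = ⟨σ_v⟩` and `−id ∈ ⟨−σ_v⟩`). "`O(V)` is generated by the set `{ρ(v) : v ∈ V, (v,v)_V = ±2}`."
[cite: Markman2023GeneralizedKummers, §5.1 (Lemma and its proof)] [cite: Wall1962OrthogonalGroups] -/
theorem hyperbolicSum_isWordIn_negReflections {n : ℕ} (hn : 3 ≤ n) (φ : (hyperbolicSum n).IsometryEquiv (hyperbolicSum n)) :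
    IsWordIn {χ : (hyperbolicSum n).IsometryEquiv (hyperbolicSum n) | ∃ s ∈ {ψ : (hyperbolicSum n).IsometryEquiv (hyperbolicSum n) |
        ∃ (r : (Fin n → ℤ) × (Fin n → ℤ)) (ε : ℤ) (hε : ε * ε = 1) (hr : hyperbolicSum n r r = ε + ε),
          ψ = normTwoReflectionEquiv (isSymm_hyperbolicSum n) r ε hr hε},
        χ = s.trans (LinearMap.BilinForm.IsometryEquiv.neg (hyperbolicSum n))} φ := by
  obtain ⟨hS, -⟩ := reflections_symm_mem_and_det' (isSymm_hyperbolicSum n)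
  obtain ⟨l, hl, hlφ⟩ := (hyperbolicSum_isWordIn_reflections hn φ).exists_list_of_symm_mem hS
  exact (isWordIn_negs_wordProd l hl (Or.inr (hyperbolicSum_isWordIn_negReflections_neg hn))).congr hlφ

/-- **`⟨−σ_v : v² = −2⟩ = O⁺(U^{⊕n})` for `n ≥ 3` EVEN** — the lattice half of "`ρ` maps `Pin(V)` onto `O₊(V)`" (`Pin(V)`
generated by the `v` with `(v,v)_V = −2`, `ρ(v) = −σ_v`; `V ≅ U^{⊕4}`): for even `n`, `−id ∈ SO⁺`, so the negated
`(−2)`-reflections lie in `O⁺` and generate it (Kneser: `O⁺ = ⟨σ_v : v² = −2⟩`).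
[cite: Markman2023GeneralizedKummers, §5.1 (Lemma: "ρ … maps Pin(V) onto O₊(V)")] [cite: GritsenkoHulekSankaran2009, Thm. 1.1] -/
theorem hyperbolicSum_isWordIn_negNegTwoReflections_iff {n : ℕ} (hn : 3 ≤ n) (heven : Even n)
    (φ : (hyperbolicSum n).IsometryEquiv (hyperbolicSum n)) :
    IsWordIn {χ : (hyperbolicSum n).IsometryEquiv (hyperbolicSum n) | ∃ s ∈ {ψ : (hyperbolicSum n).IsometryEquiv (hyperbolicSum n) |
        ∃ (r : (Fin n → ℤ) × (Fin n → ℤ)) (hr : hyperbolicSum n r r = -1 + -1),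
          ψ = normTwoReflectionEquiv (isSymm_hyperbolicSum n) r (-1) hr (by norm_num)},
        χ = s.trans (LinearMap.BilinForm.IsometryEquiv.neg (hyperbolicSum n))} φ ↔
      φ.IsOrientationPreserving := by
  have hB := isSymm_hyperbolicSum n
  have hnd := (isUnimodular_hyperbolicSum n).nondegenerate
  have hnegO : (LinearMap.BilinForm.IsometryEquiv.neg (hyperbolicSum n)).IsOrientationPreserving :=
    (hyperbolicSum_isOrientationPreserving_neg_iff n).2 heven
  obtain ⟨hS, hSdet⟩ := reflections_symm_mem_and_det hB (ε := -1) (by norm_num)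
  constructor
  · intro hφ
    refine hφ.isOrientationPreserving hB hnd fun s hs ↦ ?_
    obtain ⟨ψ, ⟨r, hr, rfl⟩, rfl⟩ := hs
    rw [LinearMap.BilinForm.IsometryEquiv.isOrientationPreserving_trans_iff hB hnd, isOrientationPreserving_normTwoReflectionEquiv_iff _ hB hnd]
    exact iff_of_true hnegO rfl
  · intro h₁
    -- `−id ∈ O⁺` is an even word in `(−2)`-reflections, hence a word in the negated ones
    have hneg : IsWordIn {χ : (hyperbolicSum n).IsometryEquiv (hyperbolicSum n) |
        ∃ s ∈ {ψ : (hyperbolicSum n).IsometryEquiv (hyperbolicSum n) | ∃ (r : (Fin n → ℤ) × (Fin n → ℤ))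
          (hr : hyperbolicSum n r r = -1 + -1), ψ = normTwoReflectionEquiv hB r (-1) hr (by norm_num)},
          χ = s.trans (LinearMap.BilinForm.IsometryEquiv.neg (hyperbolicSum n))}
        (LinearMap.BilinForm.IsometryEquiv.neg (hyperbolicSum n)) := by
      obtain ⟨l, hl, hlφ⟩ := ((hyperbolicSum_isWordIn_negTwoReflections_iff hn _).2 hnegO).exists_list_of_symm_mem hS
      have heven' : Even l.length := by
        rcases Nat.even_or_odd l.length with h | h
        · exact h
        · have hd := det_wordProd_eq_neg_one_pow l fun s hs ↦ hSdet s (hl s hs)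
          rw [DFunLike.ext _ _ hlφ, hyperbolicSum_det_neg, h.neg_one_pow] at hd
          norm_num at hd
      exact (isWordIn_negs_wordProd l hl (Or.inl heven')).congr hlφ
    obtain ⟨l, hl, hlφ⟩ := ((hyperbolicSum_isWordIn_negTwoReflections_iff hn φ).2 h₁).exists_list_of_symm_mem hS
    exact (isWordIn_negs_wordProd l hl (Or.inr hneg)).congr hlφ

/-- **`⟨(−σ_a)(−σ_b) : a² = b² = −2⟩ = SO⁺(U^{⊕n})`, `n ≥ 3`** — the lattice half of "`ρ` maps `Spin(V)` onto `SO₊(V)`" (`Spin(V) =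
Pin(V) ∩ G(V)^{even}`: even words in the `v` with `(v,v)_V = −2`): pairs of negated reflections are pairs of reflections, and
Kneser's form `SO⁺ = ⟨σ_aσ_b : a² = b² = −2⟩` (row g50-#4). [cite: Markman2023GeneralizedKummers, §5.1 (Lemma: "ρ … maps Spin(V) onto SO₊(V)")] [cite: GritsenkoHulekSankaran2009, Thm. 1.1 and Cor. 1.2] -/
theorem hyperbolicSum_isWordIn_negNegTwoReflectionPairs_iff {n : ℕ} (hn : 3 ≤ n)
    (φ : (hyperbolicSum n).IsometryEquiv (hyperbolicSum n)) :
    IsWordIn {χ : (hyperbolicSum n).IsometryEquiv (hyperbolicSum n) | ∃ (a b : (Fin n → ℤ) × (Fin n → ℤ))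
        (ha : hyperbolicSum n a a = -1 + -1) (hb : hyperbolicSum n b b = -1 + -1),
        χ = ((normTwoReflectionEquiv (isSymm_hyperbolicSum n) a (-1) ha (by norm_num)).trans
            (LinearMap.BilinForm.IsometryEquiv.neg (hyperbolicSum n))).trans
          ((normTwoReflectionEquiv (isSymm_hyperbolicSum n) b (-1) hb (by norm_num)).trans
            (LinearMap.BilinForm.IsometryEquiv.neg (hyperbolicSum n)))} φ ↔
      φ.IsOrientationPreserving ∧ LinearMap.det (φ : (Fin n → ℤ) × (Fin n → ℤ) →ₗ[ℤ] (Fin n → ℤ) × (Fin n → ℤ)) = 1 := by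
  have hset : {χ : (hyperbolicSum n).IsometryEquiv (hyperbolicSum n) | ∃ (a b : (Fin n → ℤ) × (Fin n → ℤ))
        (ha : hyperbolicSum n a a = -1 + -1) (hb : hyperbolicSum n b b = -1 + -1),
        χ = ((normTwoReflectionEquiv (isSymm_hyperbolicSum n) a (-1) ha (by norm_num)).trans
            (LinearMap.BilinForm.IsometryEquiv.neg (hyperbolicSum n))).trans
          ((normTwoReflectionEquiv (isSymm_hyperbolicSum n) b (-1) hb (by norm_num)).trans
            (LinearMap.BilinForm.IsometryEquiv.neg (hyperbolicSum n)))} =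
      {χ : (hyperbolicSum n).IsometryEquiv (hyperbolicSum n) | ∃ (a b : (Fin n → ℤ) × (Fin n → ℤ))
        (ha : hyperbolicSum n a a = -1 + -1) (hb : hyperbolicSum n b b = -1 + -1),
        χ = (normTwoReflectionEquiv (isSymm_hyperbolicSum n) a (-1) ha (by norm_num)).trans
          (normTwoReflectionEquiv (isSymm_hyperbolicSum n) b (-1) hb (by norm_num))} := by
    ext χ
    simp only [Set.mem_setOf_eq, trans_neg_trans_trans_neg]
  rw [hset]
  exact hyperbolicSum_isWordIn_negTwoReflectionPairs_iff hn φ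

end HyperbolicSum

/-! ### §3 Every lattice isometric to `U^{⊕n}` (Markman's `V ≅ U^{⊕4}`) -/

section Model

variable {W W' : Type} [AddCommGroup W] [Module.Finite ℤ W] [Module.Free ℤ W] [AddCommGroup W'] [Module.Finite ℤ W']
  [Module.Free ℤ W'] {B : BilinForm ℤ W} {B' : BilinForm ℤ W'}

omit [Module.Finite ℤ W] [Module.Free ℤ W] [Module.Finite ℤ W'] [Module.Free ℤ W'] in
/-- **Words in negated `(2ε)`-reflections (one sign, or both signs) transport along isometries** (`e⁻¹(σ_v·(−id))e =
σ_{ev}·(−id)`). [cite: GritsenkoHulekSankaran2009, §3.1 ("γσ_rγ⁻¹ = σ_{γ(r)}")] [cite: Markman2023GeneralizedKummers, §5.1] -/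
theorem IsWordIn.negReflections_conj (hB : B.IsSymm) (hB' : B'.IsSymm) (P : ℤ → Prop) {φ : B.IsometryEquiv B}
    (hφ : IsWordIn {χ : B.IsometryEquiv B | ∃ s ∈ {ψ : B.IsometryEquiv B | ∃ (r : W) (ε : ℤ) (_ : P ε) (hε : ε * ε = 1)
      (hr : B r r = ε + ε), ψ = normTwoReflectionEquiv hB r ε hr hε}, χ = s.trans (LinearMap.BilinForm.IsometryEquiv.neg B)} φ)
    (e : B.IsometryEquiv B') :
    IsWordIn {χ' : B'.IsometryEquiv B' | ∃ s ∈ {ψ' : B'.IsometryEquiv B' | ∃ (r : W') (ε : ℤ) (_ : P ε) (hε : ε * ε = 1)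
      (hr : B' r r = ε + ε), ψ' = normTwoReflectionEquiv hB' r ε hr hε}, χ' = s.trans (LinearMap.BilinForm.IsometryEquiv.neg B')}
      (e.symm.trans (φ.trans e)) := by
  refine (hφ.conj e).bind fun s hs ↦ ?_
  obtain ⟨ψ, ⟨s, ⟨r, ε, hP, hε, hr, rfl⟩, rfl⟩, rfl⟩ := hs
  have hr' : B' (e r) (e r) = ε + ε := by rw [e.map_app, hr]
  refine IsWordIn.congr (IsWordIn.of_mem (φ := (normTwoReflectionEquiv hB' (e r) ε hr' hε).trans
    (LinearMap.BilinForm.IsometryEquiv.neg B')) ⟨_, ⟨e r, ε, hP, hε, hr', rfl⟩, rfl⟩) fun v ↦ ?_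
  rw [LinearMap.BilinForm.IsometryEquiv.trans_apply, ← normTwoReflectionEquiv_conj_apply hB hB' e hr hε hr',
    LinearMap.BilinForm.IsometryEquiv.neg_apply]
  simp only [LinearMap.BilinForm.IsometryEquiv.trans_apply, LinearMap.BilinForm.IsometryEquiv.neg_apply, map_neg]

omit [Module.Finite ℤ W'] [Module.Free ℤ W'] in
/-- **`O(L) = ⟨−σ_v : v² = ±2⟩` for every `L ≅ U^{⊕n}`, `n ≥ 3`** ("`O(V)` is generated by the set `{ρ(v) : (v,v)_V = ±2}`",
`V ≅ U^{⊕4}`). [cite: Markman2023GeneralizedKummers, §5.1 (Lemma and its proof)] -/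
theorem isWordIn_negReflections_of_isometryEquiv_hyperbolicSum {n : ℕ} (hn : 3 ≤ n) (hB' : B'.IsSymm)
    (e : (hyperbolicSum n).IsometryEquiv B') (φ' : B'.IsometryEquiv B') :
    IsWordIn {χ' : B'.IsometryEquiv B' | ∃ s ∈ {ψ' : B'.IsometryEquiv B' | ∃ (r : W') (ε : ℤ) (hε : ε * ε = 1)
      (hr : B' r r = ε + ε), ψ' = normTwoReflectionEquiv hB' r ε hr hε}, χ' = s.trans (LinearMap.BilinForm.IsometryEquiv.neg B')} φ' := by
  have hw := hyperbolicSum_isWordIn_negReflections hn (e.trans (φ'.trans e.symm))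
  have hw' : IsWordIn {χ | ∃ s ∈ {ψ : (hyperbolicSum n).IsometryEquiv (hyperbolicSum n) | ∃ (r : (Fin n → ℤ) × (Fin n → ℤ)) (ε : ℤ)
      (_ : True) (hε : ε * ε = 1) (hr : hyperbolicSum n r r = ε + ε), ψ = normTwoReflectionEquiv (isSymm_hyperbolicSum n) r ε hr hε},
      χ = s.trans (LinearMap.BilinForm.IsometryEquiv.neg (hyperbolicSum n))} (e.trans (φ'.trans e.symm)) := by
    refine hw.mono fun χ hχ ↦ ?_
    obtain ⟨s, ⟨r, ε, hε, hr, rfl⟩, rfl⟩ := hχ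
    exact ⟨_, ⟨r, ε, trivial, hε, hr, rfl⟩, rfl⟩
  refine ((hw'.negReflections_conj (isSymm_hyperbolicSum n) hB' (fun _ ↦ True) e).congr fun v ↦
    IsometryEquiv.symm_trans_trans_trans_symm_trans_apply e φ' v).mono fun χ hχ ↦ ?_
  obtain ⟨s, ⟨r, ε, -, hε, hr, rfl⟩, rfl⟩ := hχ
  exact ⟨_, ⟨r, ε, hε, hr, rfl⟩, rfl⟩

/-- **`⟨−σ_v : v² = −2⟩ = O⁺(L)` for every `L ≅ U^{⊕n}`, `n ≥ 3` even** ("`ρ` maps `Pin(V)` onto `O₊(V)`", `V ≅ U^{⊕4}`).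
[cite: Markman2023GeneralizedKummers, §5.1 (Lemma)] [cite: GritsenkoHulekSankaran2009, Thm. 1.1] -/
theorem isWordIn_negNegTwoReflections_iff_of_isometryEquiv_hyperbolicSum {n : ℕ} (hn : 3 ≤ n) (heven : Even n)
    (hB' : B'.IsSymm) (hnd' : B'.Nondegenerate) (e : (hyperbolicSum n).IsometryEquiv B') (φ' : B'.IsometryEquiv B') :
    IsWordIn {χ' : B'.IsometryEquiv B' | ∃ s ∈ {ψ' : B'.IsometryEquiv B' | ∃ (r : W') (hr : B' r r = -1 + -1),
      ψ' = normTwoReflectionEquiv hB' r (-1) hr (by norm_num)}, χ' = s.trans (LinearMap.BilinForm.IsometryEquiv.neg B')} φ' ↔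
      φ'.IsOrientationPreserving := by
  have hB := isSymm_hyperbolicSum n
  constructor
  · intro hφ
    -- each generator lies in `O⁺(B′)`: `−id ∈ O⁺` transported from `U^{⊕n}` (even `n`), and `σ_r ∈ O⁺`
    have hnegO : (LinearMap.BilinForm.IsometryEquiv.neg B').IsOrientationPreserving :=
      (LinearMap.BilinForm.IsometryEquiv.isOrientationPreserving_iff_of_semiconj e
        (LinearMap.BilinForm.IsometryEquiv.neg (hyperbolicSum n)) (LinearMap.BilinForm.IsometryEquiv.neg B') fun x ↦ by
          simp only [LinearMap.BilinForm.IsometryEquiv.neg_apply, map_neg]).1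
        ((hyperbolicSum_isOrientationPreserving_neg_iff n).2 heven)
    refine hφ.isOrientationPreserving hB' hnd' fun s hs ↦ ?_
    obtain ⟨ψ, ⟨r, hr, rfl⟩, rfl⟩ := hs
    rw [LinearMap.BilinForm.IsometryEquiv.isOrientationPreserving_trans_iff hB' hnd', isOrientationPreserving_normTwoReflectionEquiv_iff _ hB' hnd']
    exact iff_of_true hnegO rfl
  · intro h₁
    have hφ : (e.trans (φ'.trans e.symm)).IsOrientationPreserving :=
      (LinearMap.BilinForm.IsometryEquiv.isOrientationPreserving_trans_trans_symm_iff e φ').2 h₁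
    have hw := (hyperbolicSum_isWordIn_negNegTwoReflections_iff hn heven _).2 hφ
    have hw' : IsWordIn {χ | ∃ s ∈ {ψ : (hyperbolicSum n).IsometryEquiv (hyperbolicSum n) | ∃ (r : (Fin n → ℤ) × (Fin n → ℤ)) (ε : ℤ)
        (_ : ε = -1) (hε : ε * ε = 1) (hr : hyperbolicSum n r r = ε + ε), ψ = normTwoReflectionEquiv hB r ε hr hε},
        χ = s.trans (LinearMap.BilinForm.IsometryEquiv.neg (hyperbolicSum n))} (e.trans (φ'.trans e.symm)) := by
      refine hw.mono fun χ hχ ↦ ?_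
      obtain ⟨s, ⟨r, hr, rfl⟩, rfl⟩ := hχ
      exact ⟨_, ⟨r, -1, rfl, by norm_num, hr, rfl⟩, rfl⟩
    refine ((hw'.negReflections_conj hB hB' (fun ε ↦ ε = -1) e).congr fun v ↦
      IsometryEquiv.symm_trans_trans_trans_symm_trans_apply e φ' v).mono fun χ hχ ↦ ?_
    obtain ⟨s, ⟨r, ε, rfl, hε, hr, rfl⟩, rfl⟩ := hχ
    exact ⟨_, ⟨r, hr, rfl⟩, rfl⟩

end Model

end Literature.Topology.FourManifolds

end
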